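import Literature.Probability.RandomPlanarGeometry.HexSAWSurfaceWallRenewalSlackTwoClassification
import Literature.Probability.RandomPlanarGeometry.HexSAWSurfaceWallRenewalIteratedGap
import HarnessLib

/-!
# Slack four, four down steps: the order `D D U D U U D U` (hairpin with a dip, then a bump) does not occur

For the self-avoiding walk on the honeycomb lattice (brick-wall frame) in the half-plane `Y ≤ 0`, consider an IRREDUCIBLE
POSITIVE WALL BRIDGE `ω ∈ ipwb m` at SLACK FOUR (`m = 6k + 4`, `k = visits m ω ≥ 2`) with FOUR down steps, in the vertical
profile of `profile_of_card_stepsD_eq_four` (`…FourDownProfile`): down times `p₁ < p₂ < p₃ < p₄`, up times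
`r₁ < r₂ < r₃ < r₄`, the initial wall run `(i, 0)`, `i ≤ p₁`, the first dive at the odd time `p₁`, all other steps horizontal.

* `dduduudu_slack_four_false` — the vertical order `p₁ < p₂ < r₁ < p₃ < r₂ < r₃ < p₄ < r₄` (word `D D U D U U D U`: one
  excursion to depth two with a dip in the middle, a wall run, then a BUMP `D U`) is impossible.

PROOF (near-renewal count; the same text as `…SlackFourFourDownHairpinBump` for the order `D D D U U U D U`, only the rows of
the five excursion runs change).  §1 is the run decomposition of the order (seven monotone body runs on the rows
`−1, −2, −1, −2, −1, 0, −1`, `run_const_velocity` of `…SecondGap`; the rightward final wall run; the visit count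
`p₁ + p₄ + m = r₃ + r₄ + 2k + 2`; column parities).  §2: the bump plateau goes RIGHT (a left plateau is crossed by the
final wall run at the dive column) and the wall run before it goes RIGHT (else the walk returns to the wall on that run, or
the plateau passes under the return site); then every interior near-renewal visit time (`NearRenewal` of `…SixStep`) on
that wall run or on the final run is a wall-renewal time (`isWRen_of_profile`), and an initial-run visit time `t ≥ 4` is
not a near-renewal (`exists_left_step_onto` at the time `2`); so `#E ≤ 1` and `slack_four_counts` (`…IteratedGap`) forces
the span `X = 2k + 2`.  But `X = c₀ + (m − r₃ − 3)` with the fresh odd return column `c₀ = X_{r₃} ≥ p₁ + 2`, and the visit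
count gives `c₀ = p₁ + p₄ + 3 − r₄ ≤ p₁ + 1` — contradiction.

STATUS: lane theorem of the a-idea-1 bridge/renewal lineage (car 94-D), fourth module of the ORDER EXCLUSION for four down
steps at slack four (FINDING-HEX-WALL-SLACK-FOUR-LAW, the four-down law `12·N = (k − 2)(2k⁴ − 7k³ + 4k² + 7k + 6)`).  OURS
(routine): checked against the lane's enumeration of all irreducible positive wall bridges at slack four for `k ≤ 8` (no
word `D D U D U U D U` among the `0, 3, 27, 129, 424, 1105, 2463` four-down walks at `k = 2 … 8`).  The printed sources carry
the renewal / irreducible-bridge structure (Madras–Slade §4.2, Definition 4.2.1, remark before (4.2.21), p. 94) and the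
brickwork frame of the honeycomb lattice (Enting–Jensen §7.4.2, Fig. 7.10) — none states this fact.
No `set_option maxHeartbeats` line is used.
-/

namespace Literature.Probability.RandomPlanarGeometry.SAW.HexBW.Wall

open Finset Filter Function
open Literature.Probability.LatticeModels Literature.Probability.Percolation SimpleGraph

variable {ω : ℕ → Site 2}

/-- [folklore] Two coordinates determine a site of `ℤ²`. -/
private theorem site_ext_db {p q : Site 2} (h0 : p 0 = q 0) (h1 : p 1 = q 1) : p = q := by
  funext k
  fin_cases k
  · exact h0
  · exact h1

/-- [folklore] Slack-four visit numerics, one interior wall run `(s, q]`. -/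
private theorem visits_count_db_w1 {k m p q s r : ℕ} (hm : m = 6 * k + 4) (hv : p / 2 + (q - s) / 2 + (m - r) / 2 = k)
    (hp : p % 2 = 1) (hq : q % 2 = 1) (hs : s % 2 = 0) (hsq : s < q) (hr : r % 2 = 0) (hrm : r < m) :
    p + q + m = s + r + 2 * k + 2 := by
  omega

/-- **Runs of the order `D D U D U U D U`.** For `m = 6k + 4`, `ω ∈ ipwb m` with `k` visits, four down steps at
`p₁ < p₂ < p₃ < p₄` and four up steps at `r₁ < r₂ < r₃ < r₄` in the order `p₂ < r₁ < p₃ < r₂`, `r₃ < p₄ < r₄`, in the profile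
of `profile_of_card_stepsD_eq_four`: the seven monotone body runs (rows `−1, −2, −1, −2, −1, 0, −1`) with their signs, the
rightward final wall run, the visit count `p₁ + p₄ + m = r₃ + r₄ + 2k + 2`, the final-run length, the column parities, the
positivity of the interior columns.  Same generator as the occurring orders (`…SlackFourFourDownRuns`, here without the gaps);
tool for `dduduudu_slack_four_false`.  OURS (routine).
[cite: MadrasSlade1993, §4.2, Definition 4.2.1 (p. 90), (4.2.2); EntingJensen2009, §7.4.2, Fig. 7.10] -/
theorem dduduudu4_runs {k m : ℕ} (hm : m = 6 * k + 4) (hω : ω ∈ ipwb m) (hv : visits m ω = k)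
    {p₁ p₂ p₃ p₄ r₁ r₂ r₃ r₄ : ℕ} (hD : stepsD m ω = {p₁, p₂, p₃, p₄}) (hU : stepsU m ω = {r₁, r₂, r₃, r₄})
    (h12 : p₁ < p₂) (h23 : p₂ < p₃) (h34 : p₃ < p₄) (hr12 : r₁ < r₂) (hr23 : r₂ < r₃) (hr34 : r₃ < r₄)
    (ht2 : p₂ < r₁) (ht3 : r₁ < p₃) (ht4 : p₃ < r₂) (ht6 : r₃ < p₄) (ht7 : p₄ < r₄) (hp1 : 1 ≤ p₁)
    (hR0 : ∀ i, i ≤ p₁ → ω i 0 = i ∧ ω i 1 = 0)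
    (hP1x : ω (p₁ + 1) 0 = p₁) (hP1y : ω (p₁ + 1) 1 = -1)
    (hhor : ∀ i, i < m → i ∉ stepsD m ω → i ∉ stepsU m ω →
      ω (i + 1) 1 = ω i 1 ∧ (ω (i + 1) 0 = ω i 0 + 1 ∨ ω (i + 1) 0 = ω i 0 - 1)) :
    ∃ e₁ e₂ e₃ e₄ e₅ e₆ e₇ : ℤ, (e₁ = 1 ∨ e₁ = -1) ∧ (e₂ = 1 ∨ e₂ = -1) ∧ (e₃ = 1 ∨ e₃ = -1) ∧ (e₄ = 1 ∨ e₄ = -1) ∧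
      (e₅ = 1 ∨ e₅ = -1) ∧ (e₆ = 1 ∨ e₆ = -1) ∧ (e₇ = 1 ∨ e₇ = -1) ∧
      (∀ i, p₁ + 1 ≤ i → i ≤ p₂ → ω i 0 = p₁ + e₁ * ((i - (p₁ + 1) : ℕ) : ℤ) ∧ ω i 1 = -1) ∧
      (∀ i, p₂ + 1 ≤ i → i ≤ r₁ → ω i 0 = ω p₂ 0 + e₂ * ((i - (p₂ + 1) : ℕ) : ℤ) ∧ ω i 1 = -2) ∧
      (∀ i, r₁ + 1 ≤ i → i ≤ p₃ → ω i 0 = ω r₁ 0 + e₃ * ((i - (r₁ + 1) : ℕ) : ℤ) ∧ ω i 1 = -1) ∧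
      (∀ i, p₃ + 1 ≤ i → i ≤ r₂ → ω i 0 = ω p₃ 0 + e₄ * ((i - (p₃ + 1) : ℕ) : ℤ) ∧ ω i 1 = -2) ∧
      (∀ i, r₂ + 1 ≤ i → i ≤ r₃ → ω i 0 = ω r₂ 0 + e₅ * ((i - (r₂ + 1) : ℕ) : ℤ) ∧ ω i 1 = -1) ∧
      (∀ i, r₃ + 1 ≤ i → i ≤ p₄ → ω i 0 = ω r₃ 0 + e₆ * ((i - (r₃ + 1) : ℕ) : ℤ) ∧ ω i 1 = 0) ∧
      (∀ i, p₄ + 1 ≤ i → i ≤ r₄ → ω i 0 = ω p₄ 0 + e₇ * ((i - (p₄ + 1) : ℕ) : ℤ) ∧ ω i 1 = -1) ∧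
      (∀ j, r₄ + 1 ≤ j → j ≤ m → ω j 0 = ω r₄ 0 + ((j - (r₄ + 1) : ℕ) : ℤ) ∧ ω j 1 = 0) ∧
      p₁ + p₄ + m = r₃ + r₄ + 2 * k + 2 ∧ ω m 0 + r₄ + 1 = ω r₄ 0 + m ∧
      ω p₂ 0 % 2 = 0 ∧ ω r₁ 0 % 2 = 0 ∧ ω p₃ 0 % 2 = 0 ∧ ω r₂ 0 % 2 = 0 ∧ ω r₃ 0 % 2 = 1 ∧ ω p₄ 0 % 2 = 1 ∧
      ω r₄ 0 % 2 = 1 ∧ 0 < ω p₂ 0 ∧ 0 < ω r₁ 0 ∧ 0 < ω p₃ 0 ∧ 0 < ω r₂ 0 ∧ 0 < ω r₃ 0 ∧ 0 < ω p₄ 0 ∧ r₄ < m := by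
  classical
  obtain ⟨hpw, hn1, hirr⟩ := mem_ipwb.1 hω
  obtain ⟨hw, hb⟩ := mem_pwb.1 hpw
  obtain ⟨ha, -⟩ := mem_wbr.1 hw
  obtain ⟨hh, -, -⟩ := mem_archs.1 ha
  obtain ⟨hs, hhp⟩ := mem_hpw.1 hh
  obtain ⟨h0, -, hbw, hinj⟩ := mem_saws_iff.1 hs
  have hX0 : ω 0 0 = 0 := by rw [h0]; rfl
  have hb' : ∀ i, 1 ≤ i → i ≤ m → 0 < ω i 0 ∧ ω i 0 ≤ ω m 0 := fun i h1 h2 => by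
    have := hb i h1 h2; rwa [hX0] at this
  have hmem : ∀ i, i ≤ m → i ∈ {i | i ≤ m} := fun i hi => hi
  have hmD : ∀ i, i ∈ stepsD m ω ↔ i = p₁ ∨ i = p₂ ∨ i = p₃ ∨ i = p₄ := fun i => by
    rw [hD]; simp only [Finset.mem_insert, Finset.mem_singleton]
  have hmU : ∀ i, i ∈ stepsU m ω ↔ i = r₁ ∨ i = r₂ ∨ i = r₃ ∨ i = r₄ := fun i => by
    rw [hU]; simp only [Finset.mem_insert, Finset.mem_singleton]
  obtain ⟨-, -, -, hpar_p₁⟩ := of_mem_stepsD_coord hbw (i := p₁) ((hmD _).2 (by simp))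
  have hx_p₁ : ω (p₁ + 1) 0 = ω p₁ 0 := by rw [hP1x, (hR0 p₁ le_rfl).1]
  have hy_p₁ : ω p₁ 1 = 0 := (hR0 p₁ le_rfl).2
  obtain ⟨hn_p₂, hx_p₂, hys_p₂, hpar_p₂⟩ := of_mem_stepsD_coord hbw (i := p₂) ((hmD _).2 (by simp))
  obtain ⟨hn_r₁, hx_r₁, hys_r₁, hpar_r₁⟩ := of_mem_stepsU_coord hbw (i := r₁) ((hmU _).2 (by simp))
  obtain ⟨hn_p₃, hx_p₃, hys_p₃, hpar_p₃⟩ := of_mem_stepsD_coord hbw (i := p₃) ((hmD _).2 (by simp))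
  obtain ⟨hn_r₂, hx_r₂, hys_r₂, hpar_r₂⟩ := of_mem_stepsU_coord hbw (i := r₂) ((hmU _).2 (by simp))
  obtain ⟨hn_r₃, hx_r₃, hys_r₃, hpar_r₃⟩ := of_mem_stepsU_coord hbw (i := r₃) ((hmU _).2 (by simp))
  obtain ⟨hn_p₄, hx_p₄, hys_p₄, hpar_p₄⟩ := of_mem_stepsD_coord hbw (i := p₄) ((hmD _).2 (by simp))
  obtain ⟨hn_r₄, hx_r₄, hys_r₄, hpar_r₄⟩ := of_mem_stepsU_coord hbw (i := r₄) ((hmU _).2 (by simp))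
  have hhor' : ∀ i, i < m → i ≠ p₁ → i ≠ p₂ → i ≠ p₃ → i ≠ p₄ → i ≠ r₁ → i ≠ r₂ → i ≠ r₃ → i ≠ r₄ →
      ω (i + 1) 1 = ω i 1 ∧ (ω (i + 1) 0 = ω i 0 + 1 ∨ ω (i + 1) 0 = ω i 0 - 1) :=
    fun i hi n1 n2 n3 n4 n5 n6 n7 n8 => hhor i hi (by rw [hmD]; omega) (by rw [hmU]; omega)
  -- run 1 on row `−1`
  obtain ⟨e1, he1, hrun1⟩ := run_const_velocity hinj (a := p₁ + 1) (b := p₂) (by omega) (by omega)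
    (fun i hi1 hi2 => hhor' i (by omega) (by omega) (by omega) (by omega) (by omega) (by omega) (by omega) (by omega) (by omega))
  have hy_p₂ : ω p₂ 1 = -1 := by rw [(hrun1 p₂ (by omega) le_rfl).2, hP1y]
  have hy1_p₂ : ω (p₂ + 1) 1 = -2 := by rw [hys_p₂, hy_p₂]; rfl
  have hparc_p₂ : ω p₂ 0 % 2 = 0 := by rw [hx_p₂, hy1_p₂] at hpar_p₂; omega
  have hpos_p₂ := (hb' p₂ (by omega) (by omega)).1
  -- run 2 on row `−2`
  obtain ⟨e2, he2, hrun2⟩ := run_const_velocity hinj (a := p₂ + 1) (b := r₁) (by omega) (by omega)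
    (fun i hi1 hi2 => hhor' i (by omega) (by omega) (by omega) (by omega) (by omega) (by omega) (by omega) (by omega) (by omega))
  have hy_r₁ : ω r₁ 1 = -2 := by rw [(hrun2 r₁ (by omega) le_rfl).2, hy1_p₂]
  have hy1_r₁ : ω (r₁ + 1) 1 = -1 := by rw [hys_r₁, hy_r₁]; rfl
  have hparc_r₁ : ω r₁ 0 % 2 = 0 := by rw [hy_r₁] at hpar_r₁; omega
  have hpos_r₁ := (hb' r₁ (by omega) (by omega)).1
  -- run 3 on row `−1`
  obtain ⟨e3, he3, hrun3⟩ := run_const_velocity hinj (a := r₁ + 1) (b := p₃) (by omega) (by omega)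
    (fun i hi1 hi2 => hhor' i (by omega) (by omega) (by omega) (by omega) (by omega) (by omega) (by omega) (by omega) (by omega))
  have hy_p₃ : ω p₃ 1 = -1 := by rw [(hrun3 p₃ (by omega) le_rfl).2, hy1_r₁]
  have hy1_p₃ : ω (p₃ + 1) 1 = -2 := by rw [hys_p₃, hy_p₃]; rfl
  have hparc_p₃ : ω p₃ 0 % 2 = 0 := by rw [hx_p₃, hy1_p₃] at hpar_p₃; omega
  have hpos_p₃ := (hb' p₃ (by omega) (by omega)).1
  -- run 4 on row `−2`
  obtain ⟨e4, he4, hrun4⟩ := run_const_velocity hinj (a := p₃ + 1) (b := r₂) (by omega) (by omega)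
    (fun i hi1 hi2 => hhor' i (by omega) (by omega) (by omega) (by omega) (by omega) (by omega) (by omega) (by omega) (by omega))
  have hy_r₂ : ω r₂ 1 = -2 := by rw [(hrun4 r₂ (by omega) le_rfl).2, hy1_p₃]
  have hy1_r₂ : ω (r₂ + 1) 1 = -1 := by rw [hys_r₂, hy_r₂]; rfl
  have hparc_r₂ : ω r₂ 0 % 2 = 0 := by rw [hy_r₂] at hpar_r₂; omega
  have hpos_r₂ := (hb' r₂ (by omega) (by omega)).1
  -- run 5 on row `−1`
  obtain ⟨e5, he5, hrun5⟩ := run_const_velocity hinj (a := r₂ + 1) (b := r₃) (by omega) (by omega)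
    (fun i hi1 hi2 => hhor' i (by omega) (by omega) (by omega) (by omega) (by omega) (by omega) (by omega) (by omega) (by omega))
  have hy_r₃ : ω r₃ 1 = -1 := by rw [(hrun5 r₃ (by omega) le_rfl).2, hy1_r₂]
  have hy1_r₃ : ω (r₃ + 1) 1 = 0 := by rw [hys_r₃, hy_r₃]; rfl
  have hparc_r₃ : ω r₃ 0 % 2 = 1 := by rw [hy_r₃] at hpar_r₃; omega
  have hpos_r₃ := (hb' r₃ (by omega) (by omega)).1
  -- run 6 on row `0`
  obtain ⟨e6, he6, hrun6⟩ := run_const_velocity hinj (a := r₃ + 1) (b := p₄) (by omega) (by omega)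
    (fun i hi1 hi2 => hhor' i (by omega) (by omega) (by omega) (by omega) (by omega) (by omega) (by omega) (by omega) (by omega))
  have hy_p₄ : ω p₄ 1 = 0 := by rw [(hrun6 p₄ (by omega) le_rfl).2, hy1_r₃]
  have hy1_p₄ : ω (p₄ + 1) 1 = -1 := by rw [hys_p₄, hy_p₄]; rfl
  have hparc_p₄ : ω p₄ 0 % 2 = 1 := by rw [hx_p₄, hy1_p₄] at hpar_p₄; omega
  have hpos_p₄ := (hb' p₄ (by omega) (by omega)).1
  -- run 7 on row `−1`
  obtain ⟨e7, he7, hrun7⟩ := run_const_velocity hinj (a := p₄ + 1) (b := r₄) (by omega) (by omega)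
    (fun i hi1 hi2 => hhor' i (by omega) (by omega) (by omega) (by omega) (by omega) (by omega) (by omega) (by omega) (by omega))
  have hy_r₄ : ω r₄ 1 = -1 := by rw [(hrun7 r₄ (by omega) le_rfl).2, hy1_p₄]
  have hy1_r₄ : ω (r₄ + 1) 1 = 0 := by rw [hys_r₄, hy_r₄]; rfl
  have hparc_r₄ : ω r₄ 0 % 2 = 1 := by rw [hy_r₄] at hpar_r₄; omega
  have htev_r₃ : r₃ % 2 = 0 := by
    have := parity_apply hs (show r₃ ≤ m by omega); rw [hy_r₃] at this; omega
  have htodd_p₄ : p₄ % 2 = 1 := by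
    have := parity_apply hs (show p₄ ≤ m by omega); rw [hy_p₄] at this; omega
  have hsev : r₄ % 2 = 0 := by have := parity_apply hs (show r₄ ≤ m by omega); rw [hy_r₄] at this; omega
  -- the final run on the wall goes right
  obtain ⟨e8, he8, hrun8⟩ := run_const_velocity hinj (a := r₄ + 1) (b := m) (by omega) le_rfl
    (fun i hi1 hi2 => hhor' i (by omega) (by omega) (by omega) (by omega) (by omega) (by omega) (by omega) (by omega)
      (by omega))
  obtain rfl : e8 = 1 := by
    rcases he8 with h | rfl
    · exact h
    exfalso
    have hN := (hrun8 m (by omega) le_rfl).1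
    have hbn := (hb' (r₄ + 1) (by omega) (by omega)).2
    rw [hx_r₄] at hN hbn
    omega
  have hR8 : ∀ j, r₄ + 1 ≤ j → j ≤ m → ω j 0 = ω r₄ 0 + ((j - (r₄ + 1) : ℕ) : ℤ) ∧ ω j 1 = 0 := fun j hj1 hj2 => by
    obtain ⟨hx, hy⟩ := hrun8 j hj1 hj2
    rw [hx_r₄] at hx; rw [hy1_r₄] at hy
    exact ⟨by rw [hx]; ring, hy⟩
  -- the visit count
  have hvf : visits m ω = p₁ / 2 + (p₄ - r₃) / 2 + (m - r₄) / 2 := by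
    have hv1 : visits p₁ ω = p₁ / 2 := visits_eq_div_two_of_wall (fun i _ hi2 => (hR0 i hi2).2)
    have hvA1 : visits r₃ ω = visits p₁ ω := by
      have := visits_add_eq_left (k := p₁) (b := r₃ - p₁) (ζ := ω) (fun j hj1 hj2 => ?_)
      · rwa [show p₁ + (r₃ - p₁) = r₃ by omega] at this
      rintro ⟨-, hy⟩
      rcases Nat.lt_or_ge (p₁ + j) (p₂ + 1) with hj1' | hj1
      · have := (hrun1 (p₁ + j) (by omega) (by omega)).2; rw [hP1y] at this; omega
      rcases Nat.lt_or_ge (p₁ + j) (r₁ + 1) with hj2' | hj2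
      · have := (hrun2 (p₁ + j) hj1 (by omega)).2; rw [hy1_p₂] at this; omega
      rcases Nat.lt_or_ge (p₁ + j) (p₃ + 1) with hj3' | hj3
      · have := (hrun3 (p₁ + j) hj2 (by omega)).2; rw [hy1_r₁] at this; omega
      rcases Nat.lt_or_ge (p₁ + j) (r₂ + 1) with hj4' | hj4
      · have := (hrun4 (p₁ + j) hj3 (by omega)).2; rw [hy1_p₃] at this; omega
      · have := (hrun5 (p₁ + j) hj4 (by omega)).2; rw [hy1_r₂] at this; omega
    have hvB1 : visits p₄ ω = visits r₃ ω + visits (p₄ - r₃) (fun _ => (0 : Site 2)) := by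
      have := visits_add (a := r₃) (b := p₄ - r₃) (ζ := ω) (ξ := fun _ => (0 : Site 2)) htev_r₃ (fun j hj1 hj2 => ?_)
      · rwa [show r₃ + (p₄ - r₃) = p₄ by omega] at this
      rw [(hrun6 (r₃ + j) (by omega) (by omega)).2, hy1_r₃]; rfl
    have hvC1 : visits (p₄ - r₃) (fun _ => (0 : Site 2)) = (p₄ - r₃) / 2 :=
      visits_eq_div_two_of_wall (fun i _ _ => rfl)
    have hvA2 : visits r₄ ω = visits p₄ ω := by
      have := visits_add_eq_left (k := p₄) (b := r₄ - p₄) (ζ := ω) (fun j hj1 hj2 => ?_)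
      · rwa [show p₄ + (r₄ - p₄) = r₄ by omega] at this
      rintro ⟨-, hy⟩
      · have := (hrun7 (p₄ + j) (by omega) (by omega)).2; rw [hy1_p₄] at this; omega
    have hv3 : visits m ω = visits r₄ ω + visits (m - r₄) (fun _ => (0 : Site 2)) := by
      have := visits_add (a := r₄) (b := m - r₄) (ζ := ω) (ξ := fun _ => (0 : Site 2)) hsev (fun j hj1 hj2 => ?_)
      · rwa [show r₄ + (m - r₄) = m by omega] at this
      rw [(hR8 (r₄ + j) (by omega) (by omega)).2]; rfl
    have hv4 : visits (m - r₄) (fun _ => (0 : Site 2)) = (m - r₄) / 2 := visits_eq_div_two_of_wall (fun i _ _ => rfl)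
    rw [hv3, hvA2, hvB1, hvA1, hv1, hvC1, hv4]
  rw [hvf] at hv
  have hpodd : p₁ % 2 = 1 := by rw [hP1x, hP1y] at hpar_p₁; omega
  have hs_eq : p₁ + p₄ + m = r₃ + r₄ + 2 * k + 2 :=
    visits_count_db_w1 hm hv hpodd htodd_p₄ htev_r₃ (show r₃ < p₄ by omega) hsev hn_r₄
  have hN' : ω m 0 + r₄ + 1 = ω r₄ 0 + m := by
    rw [(hR8 m (by omega) le_rfl).1]; omega
  refine ⟨e1, e2, e3, e4, e5, e6, e7, he1, he2, he3, he4, he5, he6, he7,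
    fun i hi1 hi2 => ⟨by rw [(hrun1 i hi1 hi2).1, hP1x], by rw [(hrun1 i hi1 hi2).2, hP1y]⟩,
    fun i hi1 hi2 => ⟨by rw [(hrun2 i hi1 hi2).1, hx_p₂], by rw [(hrun2 i hi1 hi2).2, hy1_p₂]⟩,
    fun i hi1 hi2 => ⟨by rw [(hrun3 i hi1 hi2).1, hx_r₁], by rw [(hrun3 i hi1 hi2).2, hy1_r₁]⟩,
    fun i hi1 hi2 => ⟨by rw [(hrun4 i hi1 hi2).1, hx_p₃], by rw [(hrun4 i hi1 hi2).2, hy1_p₃]⟩,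
    fun i hi1 hi2 => ⟨by rw [(hrun5 i hi1 hi2).1, hx_r₂], by rw [(hrun5 i hi1 hi2).2, hy1_r₂]⟩,
    fun i hi1 hi2 => ⟨by rw [(hrun6 i hi1 hi2).1, hx_r₃], by rw [(hrun6 i hi1 hi2).2, hy1_r₃]⟩,
    fun i hi1 hi2 => ⟨by rw [(hrun7 i hi1 hi2).1, hx_p₄], by rw [(hrun7 i hi1 hi2).2, hy1_p₄]⟩,
    hR8, hs_eq, hN', hparc_p₂, hparc_r₁, hparc_p₃, hparc_r₂, hparc_r₃, hparc_p₄, hparc_r₄, hpos_p₂, hpos_r₁, hpos_p₃,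
    hpos_r₂, hpos_r₃, hpos_p₄, hn_r₄⟩

/-- Step 1 for `dduduudu_slack_four_false`: the bump plateau goes RIGHT (a left plateau would be crossed by the final wall run
at the dive column `X_{p₄}`).  OURS (routine).
[cite: MadrasSlade1993, §4.2, Definition 4.2.1 (p. 90), remark before (4.2.21) (p. 94); EntingJensen2009, §7.4.2, Fig. 7.10] -/
theorem dduduudu_plateau {k m : ℕ} (hm : m = 6 * k + 4) (hω : ω ∈ ipwb m) (hv : visits m ω = k)
    {p₁ p₂ p₃ p₄ r₁ r₂ r₃ r₄ : ℕ} (hD : stepsD m ω = {p₁, p₂, p₃, p₄}) (hU : stepsU m ω = {r₁, r₂, r₃, r₄}) (h12 : p₁ < p₂)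
    (h23 : p₂ < p₃) (h34 : p₃ < p₄) (hr12 : r₁ < r₂) (hr23 : r₂ < r₃) (hr34 : r₃ < r₄) (ht2 : p₂ < r₁) (ht3 : r₁ < p₃) (ht4 : p₃ < r₂) (ht6 : r₃ < p₄) (ht7 : p₄ < r₄)
    (hp1 : 1 ≤ p₁)
    (hR0 : ∀ i, i ≤ p₁ → ω i 0 = i ∧ ω i 1 = 0) (hP1x : ω (p₁ + 1) 0 = p₁) (hP1y : ω (p₁ + 1) 1 = -1)
    (hhor : ∀ i, i < m → i ∉ stepsD m ω → i ∉ stepsU m ω →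
      ω (i + 1) 1 = ω i 1 ∧ (ω (i + 1) 0 = ω i 0 + 1 ∨ ω (i + 1) 0 = ω i 0 - 1)) :
    ∀ i, p₄ + 1 ≤ i → i ≤ r₄ → ω i 0 = ω p₄ 0 + ((i - (p₄ + 1) : ℕ) : ℤ) ∧ ω i 1 = -1 := by
  classical
  obtain ⟨hpw, hn1, hirr⟩ := mem_ipwb.1 hω
  obtain ⟨hw, hb⟩ := mem_pwb.1 hpw
  obtain ⟨ha, -⟩ := mem_wbr.1 hw
  obtain ⟨hh, -, -⟩ := mem_archs.1 ha
  obtain ⟨hs, hhp⟩ := mem_hpw.1 hh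
  obtain ⟨h0, -, hbw, hinj⟩ := mem_saws_iff.1 hs
  have hX0 : ω 0 0 = 0 := by rw [h0]; rfl
  have hb' : ∀ i, 1 ≤ i → i ≤ m → 0 < ω i 0 ∧ ω i 0 ≤ ω m 0 := fun i h1 h2 => by
    have := hb i h1 h2; rwa [hX0] at this
  have hmem : ∀ i, i ≤ m → i ∈ {i | i ≤ m} := fun i hi => hi
  obtain ⟨e₁, e₂, e₃, e₄, e₅, e₆, e₇, -, -, -, -, -, he6, he7, hrun1, hrun2, hrun3, hrun4, hrun5, hrun6, hrun7, hR8,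
    hs_eq, hN', -, -, -, -, hparc_r₃, hparc_p₄, hparc_r₄, -, -, -, -, hpos_r₃, -, hn_r₄⟩ :=
    dduduudu4_runs hm hω hv hD hU h12 h23 h34 hr12 hr23 hr34 ht2 ht3 ht4 ht6 ht7 hp1 hR0 hP1x hP1y hhor
  obtain ⟨-, hx_p₄, -, -⟩ := of_mem_stepsD_coord hbw (i := p₄) (by rw [hD]; simp)
  have hy_p₄ := (hrun6 p₄ (by omega) le_rfl).2
  have hy_r₃ := (hrun5 r₃ (by omega) le_rfl).2
  have hR4' := hR8 (r₄ + 1) le_rfl (by omega)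
  simp only [Nat.sub_self, Nat.cast_zero, add_zero] at hR4'
  have hR7 := (hrun7 r₄ (by omega) le_rfl).1
  obtain rfl : e₇ = 1 := by
    rcases he7 with h | rfl
    · exact h
    exfalso
    have hle := (hb' p₄ (by omega) (by omega)).2
    obtain ⟨hjx, hjy⟩ := hR8 (2 * r₄ - p₄) (by omega) (by omega)
    have hc := hinj (hmem (2 * r₄ - p₄) (by omega)) (hmem p₄ (by omega)) (site_ext_db (by omega) (by rw [hjy, hy_p₄]))
    omega
  simpa only [one_mul] using hrun7

/-- Step 2 for `dduduudu_slack_four_false`: the wall run before the bump goes RIGHT (else the walk is back on the wall at a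
site of that wall run, or the plateau passes under the return site `ω r₃`).  OURS (routine).
[cite: MadrasSlade1993, §4.2, Definition 4.2.1 (p. 90), remark before (4.2.21) (p. 94); EntingJensen2009, §7.4.2, Fig. 7.10] -/
theorem dduduudu_wallRun {k m : ℕ} (hm : m = 6 * k + 4) (hω : ω ∈ ipwb m) (hv : visits m ω = k)
    {p₁ p₂ p₃ p₄ r₁ r₂ r₃ r₄ : ℕ} (hD : stepsD m ω = {p₁, p₂, p₃, p₄}) (hU : stepsU m ω = {r₁, r₂, r₃, r₄}) (h12 : p₁ < p₂)
    (h23 : p₂ < p₃) (h34 : p₃ < p₄) (hr12 : r₁ < r₂) (hr23 : r₂ < r₃) (hr34 : r₃ < r₄) (ht2 : p₂ < r₁) (ht3 : r₁ < p₃) (ht4 : p₃ < r₂) (ht6 : r₃ < p₄) (ht7 : p₄ < r₄)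
    (hp1 : 1 ≤ p₁)
    (hR0 : ∀ i, i ≤ p₁ → ω i 0 = i ∧ ω i 1 = 0) (hP1x : ω (p₁ + 1) 0 = p₁) (hP1y : ω (p₁ + 1) 1 = -1)
    (hhor : ∀ i, i < m → i ∉ stepsD m ω → i ∉ stepsU m ω →
      ω (i + 1) 1 = ω i 1 ∧ (ω (i + 1) 0 = ω i 0 + 1 ∨ ω (i + 1) 0 = ω i 0 - 1)) :
    ∀ i, r₃ + 1 ≤ i → i ≤ p₄ → ω i 0 = ω r₃ 0 + ((i - (r₃ + 1) : ℕ) : ℤ) ∧ ω i 1 = 0 := by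
  classical
  obtain ⟨hpw, hn1, hirr⟩ := mem_ipwb.1 hω
  obtain ⟨hw, hb⟩ := mem_pwb.1 hpw
  obtain ⟨ha, -⟩ := mem_wbr.1 hw
  obtain ⟨hh, -, -⟩ := mem_archs.1 ha
  obtain ⟨hs, hhp⟩ := mem_hpw.1 hh
  obtain ⟨h0, -, hbw, hinj⟩ := mem_saws_iff.1 hs
  have hX0 : ω 0 0 = 0 := by rw [h0]; rfl
  have hb' : ∀ i, 1 ≤ i → i ≤ m → 0 < ω i 0 ∧ ω i 0 ≤ ω m 0 := fun i h1 h2 => by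
    have := hb i h1 h2; rwa [hX0] at this
  have hmem : ∀ i, i ≤ m → i ∈ {i | i ≤ m} := fun i hi => hi
  obtain ⟨e₁, e₂, e₃, e₄, e₅, e₆, e₇, -, -, -, -, -, he6, he7, hrun1, hrun2, hrun3, hrun4, hrun5, hrun6, hrun7, hR8,
    hs_eq, hN', -, -, -, -, hparc_r₃, hparc_p₄, hparc_r₄, -, -, -, -, hpos_r₃, -, hn_r₄⟩ :=
    dduduudu4_runs hm hω hv hD hU h12 h23 h34 hr12 hr23 hr34 ht2 ht3 ht4 ht6 ht7 hp1 hR0 hP1x hP1y hhor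
  obtain ⟨-, hx_p₄, -, -⟩ := of_mem_stepsD_coord hbw (i := p₄) (by rw [hD]; simp)
  have hy_p₄ := (hrun6 p₄ (by omega) le_rfl).2
  have hy_r₃ := (hrun5 r₃ (by omega) le_rfl).2
  have hR4' := hR8 (r₄ + 1) le_rfl (by omega)
  simp only [Nat.sub_self, Nat.cast_zero, add_zero] at hR4'
  have hrun7' := dduduudu_plateau hm hω hv hD hU h12 h23 h34 hr12 hr23 hr34 ht2 ht3 ht4 ht6 ht7 hp1 hR0 hP1x hP1y hhor
  have hR7 := (hrun7' r₄ (by omega) le_rfl).1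
  have hP4 := (hrun6 p₄ (by omega) le_rfl).1
  obtain rfl : e₆ = 1 := by
    rcases he6 with h | rfl
    · exact h
    exfalso
    rcases Nat.lt_or_ge (r₃ + r₄) (2 * p₄) with hlt | hge
    · obtain ⟨hjx, hjy⟩ := hrun6 (2 * p₄ - r₄ + 1) (by omega) (by omega)
      have hc := hinj (hmem (2 * p₄ - r₄ + 1) (by omega)) (hmem (r₄ + 1) (by omega))
        (site_ext_db (by rw [hR4'.1]; omega) (by rw [hjy, hR4'.2]))
      omega
    · obtain ⟨hjx, hjy⟩ := hrun7' (2 * p₄ - r₃) (by omega) (by omega)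
      have hc := hinj (hmem (2 * p₄ - r₃) (by omega)) (hmem r₃ (by omega)) (site_ext_db (by omega) (by rw [hjy, hy_r₃]))
      omega
  simpa only [one_mul] using hrun6

open Classical in
/-- Step 3 for `dduduudu_slack_four_false`: at most ONE interior visit time is a near-renewal (namely the time `2`): a
near-renewal on the last wall run or on the final wall run would be a wall-renewal time (`isWRen_of_profile`), and an
initial-run visit time `t ≥ 4` is followed by the return of the walk to the column `2`.  OURS (routine).
[cite: MadrasSlade1993, §4.2, Definition 4.2.1 (p. 90), remark before (4.2.21) (p. 94); EntingJensen2009, §7.4.2, Fig. 7.10] -/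
theorem dduduudu_card_nearRenewal_le {k m : ℕ} (hm : m = 6 * k + 4) (hω : ω ∈ ipwb m) (hv : visits m ω = k)
    {p₁ p₂ p₃ p₄ r₁ r₂ r₃ r₄ : ℕ} (hD : stepsD m ω = {p₁, p₂, p₃, p₄}) (hU : stepsU m ω = {r₁, r₂, r₃, r₄}) (h12 : p₁ < p₂)
    (h23 : p₂ < p₃) (h34 : p₃ < p₄) (hr12 : r₁ < r₂) (hr23 : r₂ < r₃) (hr34 : r₃ < r₄) (ht2 : p₂ < r₁) (ht3 : r₁ < p₃) (ht4 : p₃ < r₂) (ht6 : r₃ < p₄) (ht7 : p₄ < r₄)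
    (hp1 : 1 ≤ p₁)
    (hR0 : ∀ i, i ≤ p₁ → ω i 0 = i ∧ ω i 1 = 0) (hP1x : ω (p₁ + 1) 0 = p₁) (hP1y : ω (p₁ + 1) 1 = -1)
    (hhor : ∀ i, i < m → i ∉ stepsD m ω → i ∉ stepsU m ω →
      ω (i + 1) 1 = ω i 1 ∧ (ω (i + 1) 0 = ω i 0 + 1 ∨ ω (i + 1) 0 = ω i 0 - 1)) :
    #(((wallTimes m ω).erase m).filter fun t => NearRenewal m ω t) ≤ 1 := by
  classical
  obtain ⟨hpw, hn1, hirr⟩ := mem_ipwb.1 hω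
  obtain ⟨hw, hb⟩ := mem_pwb.1 hpw
  obtain ⟨ha, -⟩ := mem_wbr.1 hw
  obtain ⟨hh, -, -⟩ := mem_archs.1 ha
  obtain ⟨hs, hhp⟩ := mem_hpw.1 hh
  obtain ⟨h0, -, hbw, hinj⟩ := mem_saws_iff.1 hs
  have hX0 : ω 0 0 = 0 := by rw [h0]; rfl
  have hb' : ∀ i, 1 ≤ i → i ≤ m → 0 < ω i 0 ∧ ω i 0 ≤ ω m 0 := fun i h1 h2 => by
    have := hb i h1 h2; rwa [hX0] at this
  have hmem : ∀ i, i ≤ m → i ∈ {i | i ≤ m} := fun i hi => hi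
  obtain ⟨e₁, e₂, e₃, e₄, e₅, e₆, e₇, -, -, -, -, -, he6, he7, hrun1, hrun2, hrun3, hrun4, hrun5, hrun6, hrun7, hR8,
    hs_eq, hN', -, -, -, -, hparc_r₃, hparc_p₄, hparc_r₄, -, -, -, -, hpos_r₃, -, hn_r₄⟩ :=
    dduduudu4_runs hm hω hv hD hU h12 h23 h34 hr12 hr23 hr34 ht2 ht3 ht4 ht6 ht7 hp1 hR0 hP1x hP1y hhor
  obtain ⟨-, hx_p₄, -, -⟩ := of_mem_stepsD_coord hbw (i := p₄) (by rw [hD]; simp)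
  have hy_p₄ := (hrun6 p₄ (by omega) le_rfl).2
  have hy_r₃ := (hrun5 r₃ (by omega) le_rfl).2
  have hR4' := hR8 (r₄ + 1) le_rfl (by omega)
  simp only [Nat.sub_self, Nat.cast_zero, add_zero] at hR4'
  have hrun7' := dduduudu_plateau hm hω hv hD hU h12 h23 h34 hr12 hr23 hr34 ht2 ht3 ht4 ht6 ht7 hp1 hR0 hP1x hP1y hhor
  have hrun6' := dduduudu_wallRun hm hω hv hD hU h12 h23 h34 hr12 hr23 hr34 ht2 ht3 ht4 ht6 ht7 hp1 hR0 hP1x hP1y hhor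
  have hR7 := (hrun7' r₄ (by omega) le_rfl).1
  have hP4 := (hrun6' p₄ (by omega) le_rfl).1
  have htodd_p₄ : p₄ % 2 = 1 := by
    have := parity_apply hs (show p₄ ≤ m by omega); rw [hy_p₄] at this; omega
  refine le_trans (Finset.card_le_card fun t ht => ?_) (Finset.card_singleton 2).le
  rw [Finset.mem_filter, Finset.mem_erase, wallTimes, Finset.mem_filter, Finset.mem_Icc] at ht
  obtain ⟨⟨htm, ⟨ht1, htm'⟩, ht2, hy⟩, hR, hhead, htail⟩ := ht
  rw [Finset.mem_singleton]
  have htm'' : t < m := lt_of_le_of_ne htm' htm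
  rcases Nat.lt_or_ge t (p₁ + 1) with h0 | h0
  · -- an initial-run visit `t ≥ 4` is not a near-renewal: the walk comes back to the column `2`
    by_contra hne
    have ht4 : 4 ≤ t := by omega
    obtain ⟨i, him, hiL, hix⟩ := exists_left_step_onto hω (show 1 ≤ 2 by norm_num) (show 2 < m by omega) (by norm_num)
      (hR0 2 (by omega)).2 (by rw [(hR0 3 (by omega)).1, (hR0 2 (by omega)).1]; norm_num)
    have hip : p₁ ≤ i := by
      by_contra hlt
      have h1 := (hR0 (i + 1) (by omega)).1
      have h2 := (hR0 i (by omega)).1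
      rw [h1, h2] at hiL
      push_cast at hiL
      omega
    have := htail (i + 1) (by omega) (by omega)
    rw [(hR0 t (by omega)).1, hix, (hR0 2 (by omega)).1] at this
    push_cast at this
    omega
  exfalso
  rcases Nat.lt_or_ge t (p₂ + 1) with h1 | h1
  · have := (hrun1 t h0 (by omega)).2; omega
  rcases Nat.lt_or_ge t (r₁ + 1) with h2 | h2
  · have := (hrun2 t h1 (by omega)).2; omega
  rcases Nat.lt_or_ge t (p₃ + 1) with h3 | h3
  · have := (hrun3 t h2 (by omega)).2; omega
  rcases Nat.lt_or_ge t (r₂ + 1) with h4 | h4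
  · have := (hrun4 t h3 (by omega)).2; omega
  rcases Nat.lt_or_ge t (r₃ + 1) with h5 | h5
  · have := (hrun5 t h4 (by omega)).2; omega
  rcases Nat.lt_or_ge t p₄ with h6 | h6
  · -- on the last wall run: everything later lies strictly to the right, so `t` is a wall-renewal time
    refine hirr t ht1 htm'' (isWRen_of_profile hb htm' ht2 hy (fun i hi1 hi2 => ?_) fun j hj1 hj2 => ?_)
    · rcases Nat.lt_or_ge i t with hit | hit
      · have := hhead i hit; omega
      · rw [show i = t by omega]
    · have hxt := (hrun6' t h5 (by omega)).1
      rcases Nat.lt_or_ge j (p₄ + 1) with hj | hj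
      · have := (hrun6' j (by omega) (by omega)).1; omega
      rcases Nat.lt_or_ge j (r₄ + 1) with hj' | hj'
      · have := (hrun7' j hj (by omega)).1; omega
      · have := (hR8 j hj' hj2).1; omega
  rcases Nat.lt_or_ge t (p₄ + 1) with h6' | h6'
  · -- `t = p₄` is the dive time: the step after it is not to the right
    rw [show t = p₄ by omega] at hR; omega
  rcases Nat.lt_or_ge t (r₄ + 1) with h7 | h7
  · have := (hrun7 t h6' (by omega)).2; omega
  · -- on the final wall run: a wall-renewal time
    refine hirr t ht1 htm'' (isWRen_of_profile hb htm' ht2 hy (fun i hi1 hi2 => ?_) fun j hj1 hj2 => ?_)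
    · rcases Nat.lt_or_ge i t with hit | hit
      · have := hhead i hit; omega
      · rw [show i = t by omega]
    · have := (hR8 t h7 htm').1; have := (hR8 j (by omega) hj2).1; omega

open Classical in
/-- **The order `D D U D U U D U` does not occur at slack four.** For an irreducible positive wall bridge of length `6k + 4`
(`k ≥ 2`) with `k` visits and four down steps, in the vertical profile of `profile_of_card_stepsD_eq_four`, the order
`p₁ < p₂ < r₁ < p₃ < r₂ < r₃ < p₄ < r₄` of its down times `pᵢ` and up times `rᵢ` is impossible: by
`dduduudu_card_nearRenewal_le` and `slack_four_counts` the span is `2k + 2`, but the return column `X_{r₃} ≥ p₁ + 2` and the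
visit count give `X_{r₃} = p₁ + p₄ + 3 − r₄ ≤ p₁ + 1`.  NEW, a-idea-1 lineage.
[cite: MadrasSlade1993, §4.2, Definition 4.2.1 (p. 90), remark before (4.2.21) (p. 94); EntingJensen2009, §7.4.2, Fig. 7.10] -/
theorem dduduudu_slack_four_false {k m : ℕ} (hk : 2 ≤ k) (hm : m = 6 * k + 4) (hω : ω ∈ ipwb m) (hv : visits m ω = k)
    (hcD : #(stepsD m ω) = 4) {p₁ p₂ p₃ p₄ r₁ r₂ r₃ r₄ : ℕ} (hD : stepsD m ω = {p₁, p₂, p₃, p₄})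
    (hU : stepsU m ω = {r₁, r₂, r₃, r₄}) (h12 : p₁ < p₂) (h23 : p₂ < p₃) (h34 : p₃ < p₄) (hr12 : r₁ < r₂)
    (hr23 : r₂ < r₃) (hr34 : r₃ < r₄) (ht2 : p₂ < r₁) (ht3 : r₁ < p₃) (ht4 : p₃ < r₂) (ht6 : r₃ < p₄) (ht7 : p₄ < r₄)
    (hp1 : 1 ≤ p₁)
    (hR0 : ∀ i, i ≤ p₁ → ω i 0 = i ∧ ω i 1 = 0) (hP1x : ω (p₁ + 1) 0 = p₁) (hP1y : ω (p₁ + 1) 1 = -1)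
    (hhor : ∀ i, i < m → i ∉ stepsD m ω → i ∉ stepsU m ω →
      ω (i + 1) 1 = ω i 1 ∧ (ω (i + 1) 0 = ω i 0 + 1 ∨ ω (i + 1) 0 = ω i 0 - 1)) : False := by
  classical
  obtain ⟨hpw, hn1, hirr⟩ := mem_ipwb.1 hω
  obtain ⟨hw, hb⟩ := mem_pwb.1 hpw
  obtain ⟨ha, -⟩ := mem_wbr.1 hw
  obtain ⟨hh, -, -⟩ := mem_archs.1 ha
  obtain ⟨hs, hhp⟩ := mem_hpw.1 hh
  obtain ⟨h0, -, hbw, hinj⟩ := mem_saws_iff.1 hs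
  have hX0 : ω 0 0 = 0 := by rw [h0]; rfl
  have hb' : ∀ i, 1 ≤ i → i ≤ m → 0 < ω i 0 ∧ ω i 0 ≤ ω m 0 := fun i h1 h2 => by
    have := hb i h1 h2; rwa [hX0] at this
  have hmem : ∀ i, i ≤ m → i ∈ {i | i ≤ m} := fun i hi => hi
  obtain ⟨e₁, e₂, e₃, e₄, e₅, e₆, e₇, -, -, -, -, -, he6, he7, hrun1, hrun2, hrun3, hrun4, hrun5, hrun6, hrun7, hR8,
    hs_eq, hN', -, -, -, -, hparc_r₃, hparc_p₄, hparc_r₄, -, -, -, -, hpos_r₃, -, hn_r₄⟩ :=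
    dduduudu4_runs hm hω hv hD hU h12 h23 h34 hr12 hr23 hr34 ht2 ht3 ht4 ht6 ht7 hp1 hR0 hP1x hP1y hhor
  obtain ⟨-, hx_p₄, -, -⟩ := of_mem_stepsD_coord hbw (i := p₄) (by rw [hD]; simp)
  have hy_p₄ := (hrun6 p₄ (by omega) le_rfl).2
  have hy_r₃ := (hrun5 r₃ (by omega) le_rfl).2
  have hR4' := hR8 (r₄ + 1) le_rfl (by omega)
  simp only [Nat.sub_self, Nat.cast_zero, add_zero] at hR4'
  have hrun7' := dduduudu_plateau hm hω hv hD hU h12 h23 h34 hr12 hr23 hr34 ht2 ht3 ht4 ht6 ht7 hp1 hR0 hP1x hP1y hhor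
  have hrun6' := dduduudu_wallRun hm hω hv hD hU h12 h23 h34 hr12 hr23 hr34 ht2 ht3 ht4 ht6 ht7 hp1 hR0 hP1x hP1y hhor
  have hE1 := dduduudu_card_nearRenewal_le hm hω hv hD hU h12 h23 h34 hr12 hr23 hr34 ht2 ht3 ht4 ht6 ht7 hp1 hR0 hP1x hP1y hhor
  have hR7 := (hrun7' r₄ (by omega) le_rfl).1
  have hP4 := (hrun6' p₄ (by omega) le_rfl).1
  -- the span is `2k + 2`
  obtain ⟨hX3, -, -, -, -, -, h6x, -, h4x⟩ := slack_four_counts hk hm hω hv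
  have hX : ω m 0 = 2 * k + 2 := by
    rcases hX3 with h | h | h
    · exact h
    · have := ((h4x h).1 hcD).1; omega
    · have := (h6x h).1; omega
  -- the return column `c₀ = X_{r₃}` is a fresh odd wall column: `c₀ ≥ p₁ + 2`
  obtain ⟨c, hc⟩ : ∃ c : ℕ, ω r₃ 0 = c := ⟨_, (Int.toNat_of_nonneg hpos_r₃.le).symm⟩
  obtain ⟨hx3, hy3⟩ := hrun6' (r₃ + 1) le_rfl (by omega)
  simp only [Nat.sub_self, Nat.cast_zero, add_zero] at hx3
  have hpodd : p₁ % 2 = 1 := by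
    obtain ⟨-, -, -, hpar⟩ := of_mem_stepsD_coord hbw (i := p₁) (by rw [hD]; simp)
    rw [hP1x, hP1y] at hpar; omega
  have hc2 : (p₁ : ℤ) + 2 ≤ ω r₃ 0 := by
    by_contra hlt
    have hcp : c ≤ p₁ := by omega
    have := hinj (hmem (r₃ + 1) (by omega)) (hmem c (by omega))
      (site_ext_db (by rw [hx3, (hR0 c hcp).1, hc]) (by rw [hy3, (hR0 c hcp).2]))
    omega
  -- the gap `r₄ ≥ p₄ + 2` (an up step right after the last down step would return to the dive site), and the count
  have hgap7 : p₄ + 2 ≤ r₄ := by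
    by_contra h
    have h' : r₄ = p₄ + 1 := by omega
    have := hinj (hmem (r₄ + 1) (by omega)) (hmem p₄ (by omega))
      (site_ext_db (by rw [hR4'.1, hR7, h']; simp) (by rw [hR4'.2, hy_p₄]))
    omega
  omega

end Literature.Probability.RandomPlanarGeometry.SAW.HexBW.Wall
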